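import Literature.NumberTheory.LFunctions.RealZeroRepulsionOddClassSum
import Literature.Barriers.RiemannHypothesis.EpsteinZetaRealZerosPairGroupingLow
import HarnessLib

/-!
# Goldfeld–Schinzel with the classes SUMMED, in the kernel: `Re L(σ, χ_{−d}) > 0` on `[1 − c/√d, 1)`
# whenever `(√d·π/6 + 2.6c)·Σ_Q 1/a_Q ≤ (√d/c + 0.92)·h(−d)` — the `h/Σ(1/a)` mechanism

Topic `Literature/NumberTheory/LFunctions` (namespace `Literature.NumberTheory.LFunctions`, sub-namespace
`ClassSumRepulsion`). Everything in this file is PROVED (theorems only; no definition, no named fact, debt 0).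
Cell `parity-realchar` (SIEGEL INSTRUMENT): TARGET §2 row 16 (universal effective repulsion of real zeros),
ODD column, v5 — the class-SUMMED form of `RealZeroRepulsionOddClassSum.lean` (v4, class-ISOLATED).

## The point

`χ` odd real primitive mod `d > 4`, `h = h(−d)` = number of reduced forms `Q = (a_Q, b_Q, c_Q)` of
discriminant `−d`, `ζ(s)L(s, χ) = ½ Σ_Q Z_Q(s)` (tree), `Z_Q(σ) = κ_d(σ)·Λ_{z_Q}(σ)` with ONE positive factor
`κ_d(σ) = π^σ(√d/2)^{−σ}/Γ(σ)` for all classes and `Im z_Q = √d/(2a_Q)`. The v4 file shows each class is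
negative at `σ = 1 − δ` as long as `√d(π/6 + 2.6δ) ≤ 1/δ + 0.92`; the principal class (`a = 1`) alone then
caps the admissible `δ√d` at `6/π` (Goldfeld–Schinzel's Corollary constant). But only the SUM has to be
negative. Here:

* `re_thetaΛ_lt_uniform` — for EVERY `z` with `Im z ≥ 4/5` and `0 < δ ≤ 1/10` (round lattices
  `4/5 ≤ Im z ≤ 1` by the tree's quantitative majorant bound `re_Λ_le_of_im_le_one`,
  `Re Λ_z(σ) ≤ 5/6 − 1/σ − 1/(1−σ)`):
  **`Re Λ_z(1 − δ) < 2·Im z·(π/6 + 2.6δ) − 1/δ − 0.92`** (for `Im z ≥ 1` this is the v4 per-class bound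
  `re_thetaΛ_lt_of_one_le_im`; round lattices satisfy it with room);
* `re_lt_of_mem_reducedForms_uniform` — for every reduced `Q` of discriminant `−d` and every continuation
  `Z` of `ζ_Q`: **`Re Z(1 − δ) < κ_d(1−δ)·[(√d/a_Q)(π/6 + 2.6δ) − 1/δ − 0.92]`**;
* summing over the `h` classes: `Σ_Q Re Z_Q(1−δ) < κ_d(1−δ)·[√d(π/6 + 2.6δ)·S − h(1/δ + 0.92)]`,
  `S = Σ_Q 1/a_Q`; so (`LFunction_re_pos_of_odd_quadratic_summed`) **if `0 < c`, `10c ≤ √d` and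
  `(√d·π/6 + 2.6c)·S ≤ (√d/c + 0.92)·h`, then `Re L(σ, χ) > 0` for `1 − c/√d ≤ σ < 1`** (and
  `L(σ, χ) ≠ 0` there; `one_sub_realZero_gt_of_classSum`: every real zero `β < 1` has `1 − β > c/√d`);
  the handier sufficient condition `c·(π/6 + 2.6c/√d)·S ≤ h` is `LFunction_re_pos_of_ratio`;
* field side (`…_field`): the same with `h = h_K` for every imaginary quadratic `K` with `d_K = −d`
  (tree `Quadratic.card_reducedForms_eq_classNumber`).

This is exactly the mechanism of Goldfeld–Schinzel 1975 (Theorem 1: `1 − β ∼ (6/π²)L(1,χ)/Σ'1/a`, i.e.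
`≈ (6/π)(h/Σ_Q 1/a_Q)/√d` with `L(1,χ) = πh/√d`) and of Ralaivaosaona–Razakarinoro 2026 (Theorem 1,
`6.035/√d` for `d > 3·10⁸` via `Σ 1/a ≤ h/11` when `h ≥ 101`), but with the tree's Epstein/theta constant-term
decomposition in place of Perron's formula and a shifted contour: the admissible constant is
`c ≈ (6/π)·h/S` up to `O(c²/√d)`, with no further loss. Since `a_Q ≥ 1` gives `S ≤ h`, the v4 constant `6/π − ε`
is the case `h/S ≥ 1`; the leading-coefficient count `S ≤ h/30 + 6.2605` (companion file
`Literature/NumberTheory/QuadraticFields/ReducedFormsLeadingCoefficients.lean`) turns `h ≥ 101` into `c = 18`.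

LABEL (cell rule): TARGET row 16 ODD column, kernel, hypothesis-free master inequality. WHAT THIS IS NOT: nothing
for even characters (indefinite forms); no lower bound for `h(−d)` is proved here (that input — Watkins' class
number tables — enters only in the companion numerics file, as a named fact); nothing here bears on parity (H5).

## References (context)

* [GoldfeldSchinzel1975] D. M. Goldfeld, A. Schinzel, *On Siegel's zero*, Ann. Sc. Norm. Super. Pisa (4) 2 (1975)
  571–583, Theorem 1 and Corollary (case `d < 0`).
* [RalaivaosaonaRazakarinoro2026] D. Ralaivaosaona, F. B. Razakarinoro, J. Number Theory 281 (2026) 795–829,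
  Theorem 1, Lemma 2 (`Σ_{a ≤ √d/2} ν(a)/a ≤ h/11` for `h ≥ 101`), §6.
* [BatemanGrosswald1964] Theorems 1–2 (constant term, Bessel part).
* [MontgomeryVaughan2007] Corollary 11.12 and §11.5 notes.
-/

noncomputable section

open Complex Filter Topology MeasureTheory Set HurwitzZeta
open scoped UpperHalfPlane
open Literature.Barriers.RiemannHypothesis
open Literature.Barriers.Parity
open Literature.NumberTheory.Automorphic
open Literature.NumberTheory.LFunctions.RealZeros
open Literature.NumberTheory.QuadraticFields Literature.NumberTheory.QuadraticFields.Quadratic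
open Literature.NumberTheory.QuadraticFields.BinaryQuadraticForm (reducedForms mem_reducedForms_iff
  le_of_isReduced discr_apply)

namespace Literature.NumberTheory.LFunctions

namespace ClassSumRepulsion

/-! ### The uniform per-lattice bound -/

/-- Numerics: `π/6 > 0.5235`. [folklore] -/
private theorem pi_div_six_gt : (0.5235 : ℝ) < Real.pi / 6 := by
  have := Real.pi_gt_d4
  linarith

/-- **Uniform per-lattice bound just left of `s = 1`**: for every `z` with `Im z ≥ 4/5` and `0 < δ ≤ 1/10`,
`Re Λ_z(1 − δ) < 2·Im z·(π/6 + 2.6δ) − 1/δ − 0.92`. For `Im z ≥ 1` this is the constant-term bound of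
`RealZeroRepulsionOddClassSum.lean` (`re_thetaΛ_lt_of_one_le_im`); for `4/5 ≤ Im z ≤ 1` the round bound
`5/6 − 1/(1−δ) − 1/δ ≤ −1/6 − 1/δ` is smaller still (`2·(4/5)·π/6 − 0.92 > −0.09`).
[cite: BatemanGrosswald1964, Theorem 1 (3)–(5) and Theorem 2 (8)] -/
theorem re_thetaΛ_lt_uniform (z : ℍ) (hy : 4 / 5 ≤ z.im) {δ : ℝ} (hδ0 : 0 < δ) (hδ1 : δ ≤ 1 / 10) :
    ((thetaFEPair z).Λ ((1 - δ : ℝ) : ℂ)).re <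
      2 * z.im * (Real.pi / 6 + 2.6 * δ) - 1 / δ - 0.92 := by
  rcases le_or_gt 1 z.im with h1 | h1
  · exact re_thetaΛ_lt_of_one_le_im z h1 hδ0 hδ1
  · have h := re_Λ_le_of_im_le_one z hy h1.le (σ := 1 - δ) (by linarith) (by linarith)
    rw [show (1 : ℝ) - (1 - δ) = δ by ring] at h
    have hone : 1 ≤ 1 / (1 - δ) := by
      rw [le_div_iff₀ (by linarith)]; linarith
    have hπ6 := pi_div_six_gt
    have hpos : (8 / 5 : ℝ) * 0.5235 ≤ 2 * z.im * (Real.pi / 6 + 2.6 * δ) := by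
      have h2 : (0 : ℝ) ≤ 2.6 * δ := by positivity
      nlinarith
    linarith

/-! ### The uniform per-class bound for reduced forms -/

/-- **Every reduced class just left of `s = 1`, quantitatively.** For a reduced form `(A, B, C)` of
discriminant `−d` (`d > 4`), any continuation `Z` of `ζ_Q`, and `0 < δ ≤ 1/10`:
`Re Z(1 − δ) < κ_d(1−δ)·[(√d/A)(π/6 + 2.6δ) − 1/δ − 0.92]` with the class-independent positive factor
`κ_d(σ) = π^σ(√d/2)^{−σ}/Γ(σ)` (`Z(σ) = κ_d(σ)Λ_{z'}(σ)`, `Im z' = √d/(2A) ≥ √3/2 > 4/5` for a reduced form).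
[cite: MontgomeryVaughan2007, Corollary 11.12 and §11.5 notes] -/
theorem re_lt_of_mem_reducedForms_uniform {d : ℕ} (hd : 4 < d) {A B C : ℤ}
    (hQ : (A, B, C) ∈ reducedForms (-(d : ℤ))) {Z : ℂ → ℂ}
    (hZ : IsEpsteinContinuation (A : ℝ) (B : ℝ) (C : ℝ) Z) {δ : ℝ} (hδ0 : 0 < δ) (hδ1 : δ ≤ 1 / 10) :
    (Z ((1 - δ : ℝ) : ℂ)).re <
      Real.pi ^ (1 - δ) * (Real.sqrt d / 2) ^ (-(1 - δ)) / Real.Gamma (1 - δ) *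
        (Real.sqrt d / A * (Real.pi / 6 + 2.6 * δ) - 1 / δ - 0.92) := by
  have hD0 : (-(d : ℤ)) < 0 := by omega
  obtain ⟨hdisc, ha, -, hred⟩ := (mem_reducedForms_iff hD0).1 hQ
  obtain ⟨-, hb1, hb2, hac⟩ := le_of_isReduced hdisc ha hred
  simp only at ha
  rw [discr_apply] at hdisc
  have hbsq : B ^ 2 ≤ A ^ 2 := by nlinarith
  have h3a : 3 * A ^ 2 ≤ (d : ℤ) := by nlinarith
  have haR : (1 : ℝ) ≤ A := by exact_mod_cast ha
  have hdR : (4 : ℝ) * A * C - (B : ℝ) ^ 2 = d := by exact_mod_cast (by linarith : 4 * A * C - B ^ 2 = (d : ℤ))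
  have h3aR : 3 * (A : ℝ) ^ 2 ≤ d := by exact_mod_cast h3a
  have hd4R : (4 : ℝ) < d := by exact_mod_cast hd
  have hpos : IsPosDefForm (A : ℝ) (B : ℝ) (C : ℝ) := ⟨by linarith, by linarith⟩
  have hk : starkK (A : ℝ) (B : ℝ) (C : ℝ) = Real.sqrt d / (2 * A) := by rw [starkK, hdR]
  have hsd : 2 ≤ Real.sqrt d := (Real.le_sqrt' two_pos).2 (by linarith)
  have hsd0 : 0 < Real.sqrt d := by linarith
  have hk45 : 4 / 5 ≤ starkK (A : ℝ) (B : ℝ) (C : ℝ) := by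
    rw [hk, le_div_iff₀ (by positivity), Real.le_sqrt' (by positivity)]
    nlinarith
  set σ : ℝ := 1 - δ with hσdef
  have hσ0 : (0 : ℝ) < σ := by rw [hσdef]; linarith
  have hσ1 : σ < 1 := by rw [hσdef]; linarith
  -- transfer to `Λ_{z'}` with `Im z' = k = √d/(2A)`
  obtain ⟨z, hre, him, hk'⟩ := exists_zQ' hpos
  have hZ' : IsEpsteinContinuation (C : ℝ) (B : ℝ) (A : ℝ) Z :=
    (isEpsteinContinuation_swap_iff (A : ℝ) (B : ℝ) (C : ℝ) Z).2 hZ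
  have hσc : ((1 - δ : ℝ) : ℂ) = (σ : ℂ) := by rw [hσdef]
  rw [hσc, continuation_ofReal_eq hpos.swap z hre him hZ' hσ0 hσ1, Complex.re_ofReal_mul]
  have h4 : (4 : ℝ) * C * A - (B : ℝ) ^ 2 = d := by linarith
  rw [h4]
  have hκ : 0 < Real.pi ^ σ * (Real.sqrt d / 2) ^ (-σ) / Real.Gamma σ := by
    have h1 : 0 < Real.pi ^ σ := Real.rpow_pos_of_pos Real.pi_pos σ
    have h2 : 0 < (Real.sqrt d / 2) ^ (-σ) := Real.rpow_pos_of_pos (by positivity) _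
    have h3 := Real.Gamma_pos_of_pos hσ0
    positivity
  refine mul_lt_mul_of_pos_left ?_ hκ
  rw [← hk'] at hk45
  have hlt := re_thetaΛ_lt_uniform z hk45 hδ0 hδ1
  have h2k : 2 * z.im = Real.sqrt d / A := by
    rw [hk', hk]; field_simp
  rw [h2k, hσc] at hlt
  exact hlt

/-! ### The class sum: `Re L(σ, χ) > 0` on `[1 − c/√d, 1)` under the `h/Σ(1/a)` condition -/

/-- **Class-summed Goldfeld–Schinzel (kernel): `Re L(σ, χ) > 0` on `[1 − c/√d, 1)`** for the odd real primitive
character `χ` mod `d > 4`, whenever `0 < c`, `10c ≤ √d` and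
`(√d·π/6 + 2.6c)·Σ_{Q reduced} 1/a_Q ≤ (√d/c + 0.92)·h(−d)` (`h(−d)` = the number of reduced forms of
discriminant `−d`). Proof: `ζ(σ)L(σ,χ) = ½Σ_Q Z_Q(σ)` (tree, continued to `σ`), each
`Re Z_Q(1−δ) < κ[(√d/a_Q)(π/6 + 2.6δ) − 1/δ − 0.92]` (`re_lt_of_mem_reducedForms_uniform`), the sum of the
brackets is `√d(π/6 + 2.6δ)S − h(1/δ + 0.92) ≤ 0` for `δ ≤ c/√d` by the hypothesis, and `ζ(σ) < 0`.
[cite: GoldfeldSchinzel1975, Theorem 1 and Corollary (case d < 0)]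
[cite: RalaivaosaonaRazakarinoro2026, Theorem 1 and Lemma 2] -/
theorem LFunction_re_pos_of_odd_quadratic_summed {d : ℕ} [NeZero d] (hd : 4 < d)
    {χ : DirichletCharacter ℂ d} (hprim : χ.IsPrimitive) (hquad : χ.IsQuadratic) (hodd : χ.Odd)
    {c₀ : ℝ} (hc0 : 0 < c₀) (h10 : 10 * c₀ ≤ Real.sqrt d)
    (hS : (Real.sqrt d * (Real.pi / 6) + 2.6 * c₀) * ∑ Q ∈ reducedForms (-(d : ℤ)), (1 : ℝ) / (Q.1 : ℝ) ≤
      (Real.sqrt d / c₀ + 0.92) * (BinaryQuadraticForm.classNumber (-(d : ℤ)) : ℝ))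
    {σ : ℝ} (hσ : 1 - c₀ / Real.sqrt d ≤ σ) (hσ1 : σ < 1) : 0 < (χ.LFunction σ).re := by
  classical
  have hd4R : (4 : ℝ) < d := by exact_mod_cast hd
  have hsd : 2 ≤ Real.sqrt d := (Real.le_sqrt' two_pos).2 (by linarith)
  have hsd0 : 0 < Real.sqrt d := by linarith
  -- `δ = 1 − σ ∈ (0, c₀/√d] ⊂ (0, 1/10]`
  set δ : ℝ := 1 - σ with hδdef
  have hδ0 : 0 < δ := by rw [hδdef]; linarith
  have hδc : δ ≤ c₀ / Real.sqrt d := by rw [hδdef]; linarith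
  have hcd : c₀ / Real.sqrt d ≤ 1 / 10 := by
    rw [div_le_div_iff₀ hsd0 (by norm_num)]; linarith
  have hδ1 : δ ≤ 1 / 10 := hδc.trans hcd
  have h3 : Real.sqrt d / c₀ ≤ 1 / δ := by
    rw [div_le_div_iff₀ hc0 hδ0]
    have := mul_le_mul_of_nonneg_left hδc hsd0.le
    rw [mul_div_cancel₀ _ hsd0.ne'] at this
    linarith
  have hσ0 : 0 < σ := by linarith
  have hσeq : ((1 - δ : ℝ) : ℂ) = (σ : ℂ) := by rw [hδdef]; push_cast; ring
  have hχ1 : χ ≠ 1 := by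
    intro h
    have h1 : χ (-1) = -1 := hodd
    rw [h, MulChar.one_apply (isUnit_one.neg)] at h1
    norm_num at h1
  set S := reducedForms (-(d : ℤ)) with hS'
  -- continuations of the class zeta functions
  have hex : ∀ Q : ℤ × ℤ × ℤ, ∃ Z : ℂ → ℂ,
      Q ∈ S → IsEpsteinContinuation (Q.1 : ℝ) (Q.2.1 : ℝ) (Q.2.2 : ℝ) Z := by
    intro Q
    by_cases hQ : Q ∈ S
    · have hD0 : (-(d : ℤ)) < 0 := by omega
      obtain ⟨hdisc, ha, -, hred⟩ := (mem_reducedForms_iff hD0).1 hQ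
      obtain ⟨-, hb1, hb2, hac⟩ := le_of_isReduced (a := Q.1) (b := Q.2.1) (c := Q.2.2) hdisc ha hred
      rw [show Q = (Q.1, Q.2.1, Q.2.2) from rfl, discr_apply] at hdisc
      have hpos : IsPosDefForm (Q.1 : ℝ) (Q.2.1 : ℝ) (Q.2.2 : ℝ) := by
        refine ⟨by exact_mod_cast ha, ?_⟩
        have : (Q.2.1 : ℝ) ^ 2 - 4 * (Q.1 : ℝ) * (Q.2.2 : ℝ) = ((-(d : ℤ) : ℤ) : ℝ) := by
          exact_mod_cast hdisc
        rw [this]; push_cast; linarith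
      obtain ⟨Z, hZ, -⟩ := MontgomeryVaughan2007_epsteinContinuation_holds _ _ _ hpos
      exact ⟨Z, fun _ => hZ⟩
    · exact ⟨0, fun h => absurd h hQ⟩
  choose Z hZ using hex
  set G : ℂ → ℂ := fun s => 1 / 2 * ∑ Q ∈ S, Z Q s with hGdef
  set F : ℂ → ℂ := fun s => riemannZeta s * χ.LFunction s with hFdef
  have hU : IsOpen {s : ℂ | s ≠ 1} := isOpen_ne
  have hFd : DifferentiableOn ℂ F {s : ℂ | s ≠ 1} := fun s hs =>
    ((differentiableAt_riemannZeta hs).mul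
      ((DirichletCharacter.differentiable_LFunction hχ1) s)).differentiableWithinAt
  have hGd : DifferentiableOn ℂ G {s : ℂ | s ≠ 1} :=
    (differentiableOn_const _).mul (DifferentiableOn.fun_sum fun Q hQ => (hZ Q hQ).1)
  have hFG : EqOn F G {s : ℂ | s ≠ 1} := by
    refine (hFd.analyticOnNhd hU).eqOn_of_preconnected_of_eventuallyEq (hGd.analyticOnNhd hU)
      isPreconnected_compl_one (show (2 : ℂ) ∈ {s : ℂ | s ≠ 1} by norm_num) ?_
    have hopen : IsOpen {s : ℂ | 1 < s.re} := isOpen_lt continuous_const Complex.continuous_re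
    filter_upwards [hopen.mem_nhds (show (2 : ℂ) ∈ {s : ℂ | 1 < s.re} by simp)] with s hs
    have hs' : 1 < s.re := hs
    simp only [hFdef, hGdef]
    rw [riemannZeta_mul_LFunction_eq_half_sum_of_one_lt_re hd hprim hquad hodd hs']
    congr 1
    exact Finset.sum_congr rfl fun Q hQ => ((hZ Q hQ).2 s hs').symm
  -- at the real point `σ`
  have hσU : ((σ : ℂ)) ∈ {s : ℂ | s ≠ 1} := by
    simp only [Set.mem_setOf_eq]
    exact_mod_cast hσ1.ne
  have heq := hFG hσU
  simp only [hFdef, hGdef] at heq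
  -- the common positive factor and the per-class brackets
  set κ : ℝ := Real.pi ^ (1 - δ) * (Real.sqrt d / 2) ^ (-(1 - δ)) / Real.Gamma (1 - δ) with hκdef
  have hκ0 : 0 < κ := by
    have h1 : 0 < Real.pi ^ (1 - δ) := Real.rpow_pos_of_pos Real.pi_pos _
    have h2 : 0 < (Real.sqrt d / 2) ^ (-(1 - δ)) := Real.rpow_pos_of_pos (by positivity) _
    have h3 := Real.Gamma_pos_of_pos (show (0 : ℝ) < 1 - δ by linarith)
    positivity
  have hterm : ∀ Q ∈ S, (Z Q σ).re <
      κ * (Real.sqrt d / (Q.1 : ℝ) * (Real.pi / 6 + 2.6 * δ) - 1 / δ - 0.92) := fun Q hQ => by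
    have h := re_lt_of_mem_reducedForms_uniform hd (A := Q.1) (B := Q.2.1) (C := Q.2.2) hQ (hZ Q hQ)
      hδ0 hδ1
    rwa [hσeq] at h
  -- the class sum is non-empty (else `ζ(2)L(2, χ) = 0`)
  have hne : S.Nonempty := by
    by_contra hS0
    rw [Finset.not_nonempty_iff_eq_empty] at hS0
    have h2 := hFG (show (2 : ℂ) ∈ {s : ℂ | s ≠ 1} by norm_num)
    simp only [hFdef, hGdef, hS0, Finset.sum_empty, mul_zero] at h2
    exact mul_ne_zero (riemannZeta_ne_zero_of_one_lt_re (by norm_num))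
      (χ.LFunction_ne_zero_of_one_le_re (Or.inl hχ1) (by norm_num)) h2
  -- summing the brackets
  have hcard : S.card = BinaryQuadraticForm.classNumber (-(d : ℤ)) := rfl
  have hsumlt : ∑ Q ∈ S, (Z Q σ).re <
      ∑ Q ∈ S, κ * (Real.sqrt d / (Q.1 : ℝ) * (Real.pi / 6 + 2.6 * δ) - 1 / δ - 0.92) :=
    Finset.sum_lt_sum_of_nonempty hne hterm
  have hsumeq : ∑ Q ∈ S, κ * (Real.sqrt d / (Q.1 : ℝ) * (Real.pi / 6 + 2.6 * δ) - 1 / δ - 0.92) =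
      κ * (Real.sqrt d * (Real.pi / 6 + 2.6 * δ) * ∑ Q ∈ S, (1 : ℝ) / (Q.1 : ℝ) -
        (S.card : ℝ) * (1 / δ + 0.92)) := by
    have e : ∀ Q : ℤ × ℤ × ℤ, κ * (Real.sqrt d / (Q.1 : ℝ) * (Real.pi / 6 + 2.6 * δ) - 1 / δ - 0.92) =
        κ * (Real.sqrt d * (Real.pi / 6 + 2.6 * δ)) * ((1 : ℝ) / (Q.1 : ℝ)) - κ * (1 / δ + 0.92) := by
      intro Q; ring
    simp_rw [e]
    rw [Finset.sum_sub_distrib, ← Finset.mul_sum, Finset.sum_const, nsmul_eq_mul]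
    ring
  -- the bracket sum is `≤ 0`
  have hSnn : 0 ≤ ∑ Q ∈ S, (1 : ℝ) / (Q.1 : ℝ) := by
    refine Finset.sum_nonneg fun Q hQ => ?_
    have hD0 : (-(d : ℤ)) < 0 := by omega
    obtain ⟨-, ha, -, -⟩ := (mem_reducedForms_iff hD0).1 hQ
    have : (0 : ℝ) < Q.1 := by exact_mod_cast ha
    positivity
  have hbr : Real.sqrt d * (Real.pi / 6 + 2.6 * δ) * ∑ Q ∈ S, (1 : ℝ) / (Q.1 : ℝ) -
      (S.card : ℝ) * (1 / δ + 0.92) ≤ 0 := by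
    rw [hcard]
    set T := ∑ Q ∈ S, (1 : ℝ) / (Q.1 : ℝ) with hT
    set h : ℝ := (BinaryQuadraticForm.classNumber (-(d : ℤ)) : ℝ) with hh
    have hh0 : 0 ≤ h := by rw [hh]; positivity
    have h1 : Real.sqrt d * (Real.pi / 6 + 2.6 * δ) * T ≤ (Real.sqrt d * (Real.pi / 6) + 2.6 * c₀) * T := by
      refine mul_le_mul_of_nonneg_right ?_ hSnn
      have : Real.sqrt d * (2.6 * δ) ≤ 2.6 * c₀ := by
        have := mul_le_mul_of_nonneg_left hδc hsd0.le
        rw [mul_div_cancel₀ _ hsd0.ne'] at this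
        linarith
      linarith
    have h2 : (Real.sqrt d / c₀ + 0.92) * h ≤ (1 / δ + 0.92) * h :=
      mul_le_mul_of_nonneg_right (by linarith) hh0
    linarith
  have hGneg : (1 / 2 * ∑ Q ∈ S, Z Q σ).re < 0 := by
    rw [show (1 : ℂ) / 2 = ((1 / 2 : ℝ) : ℂ) by push_cast; ring, Complex.re_ofReal_mul, Complex.re_sum]
    rw [hsumeq] at hsumlt
    have : κ * (Real.sqrt d * (Real.pi / 6 + 2.6 * δ) * ∑ Q ∈ S, (1 : ℝ) / (Q.1 : ℝ) -
        (S.card : ℝ) * (1 / δ + 0.92)) ≤ 0 := mul_nonpos_of_nonneg_of_nonpos hκ0.le hbr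
    linarith
  rw [← heq, Complex.mul_re, riemannZeta_im_eq_zero_of_pos hσ0 hσ1.ne, zero_mul, sub_zero] at hGneg
  exact pos_of_mul_neg_right hGneg (riemannZeta_re_neg_of_pos_of_lt_one hσ0 hσ1).le

/-- **No real zero of `L(s, χ)` in `[1 − c/√d, 1)`** under the same class-sum condition.
[cite: GoldfeldSchinzel1975, Theorem 1 and Corollary (case d < 0)] -/
theorem LFunction_ne_zero_of_odd_quadratic_summed {d : ℕ} [NeZero d] (hd : 4 < d)
    {χ : DirichletCharacter ℂ d} (hprim : χ.IsPrimitive) (hquad : χ.IsQuadratic) (hodd : χ.Odd)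
    {c₀ : ℝ} (hc0 : 0 < c₀) (h10 : 10 * c₀ ≤ Real.sqrt d)
    (hS : (Real.sqrt d * (Real.pi / 6) + 2.6 * c₀) * ∑ Q ∈ reducedForms (-(d : ℤ)), (1 : ℝ) / (Q.1 : ℝ) ≤
      (Real.sqrt d / c₀ + 0.92) * (BinaryQuadraticForm.classNumber (-(d : ℤ)) : ℝ))
    {σ : ℝ} (hσ : 1 - c₀ / Real.sqrt d ≤ σ) (hσ1 : σ < 1) : χ.LFunction σ ≠ 0 := by
  intro h0
  have h := LFunction_re_pos_of_odd_quadratic_summed hd hprim hquad hodd hc0 h10 hS hσ hσ1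
  rw [h0, Complex.zero_re] at h
  exact lt_irrefl _ h

/-- **`1 − β > c/√d` for every real zero `β < 1`** under the class-sum condition (form side).
[cite: GoldfeldSchinzel1975, Theorem 1 and Corollary (case d < 0)] -/
theorem one_sub_realZero_gt_of_classSum {d : ℕ} [NeZero d] (hd : 4 < d)
    {χ : DirichletCharacter ℂ d} (hprim : χ.IsPrimitive) (hquad : χ.IsQuadratic) (hodd : χ.Odd)
    {c₀ : ℝ} (hc0 : 0 < c₀) (h10 : 10 * c₀ ≤ Real.sqrt d)
    (hS : (Real.sqrt d * (Real.pi / 6) + 2.6 * c₀) * ∑ Q ∈ reducedForms (-(d : ℤ)), (1 : ℝ) / (Q.1 : ℝ) ≤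
      (Real.sqrt d / c₀ + 0.92) * (BinaryQuadraticForm.classNumber (-(d : ℤ)) : ℝ))
    {β : ℝ} (hβ1 : β < 1) (hz : χ.LFunction β = 0) : c₀ / Real.sqrt d < 1 - β := by
  by_contra hcon
  push Not at hcon
  exact LFunction_ne_zero_of_odd_quadratic_summed hd hprim hquad hodd hc0 h10 hS (by linarith) hβ1 hz

/-- **The ratio form of the condition**: `c·(π/6 + 2.6c/√d)·S ≤ h(−d)` (with `0 < c`, `10c ≤ √d`) implies the
class-sum condition `(√d·π/6 + 2.6c)·S ≤ (√d/c + 0.92)·h(−d)` — i.e. the admissible constant is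
`c ≈ (6/π)·h/S`. [cite: GoldfeldSchinzel1975, Theorem 1 (case d < 0)] -/
theorem classSum_condition_of_ratio {d : ℕ} (hd : 4 < d) {c₀ : ℝ} (hc0 : 0 < c₀)
    (hr : c₀ * (Real.pi / 6 + 2.6 * c₀ / Real.sqrt d) * ∑ Q ∈ reducedForms (-(d : ℤ)), (1 : ℝ) / (Q.1 : ℝ) ≤
      (BinaryQuadraticForm.classNumber (-(d : ℤ)) : ℝ)) :
    (Real.sqrt d * (Real.pi / 6) + 2.6 * c₀) * ∑ Q ∈ reducedForms (-(d : ℤ)), (1 : ℝ) / (Q.1 : ℝ) ≤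
      (Real.sqrt d / c₀ + 0.92) * (BinaryQuadraticForm.classNumber (-(d : ℤ)) : ℝ) := by
  have hd4R : (4 : ℝ) < d := by exact_mod_cast hd
  have hsd : 2 ≤ Real.sqrt d := (Real.le_sqrt' two_pos).2 (by linarith)
  have hsd0 : 0 < Real.sqrt d := by linarith
  set T := ∑ Q ∈ reducedForms (-(d : ℤ)), (1 : ℝ) / (Q.1 : ℝ) with hT
  set h : ℝ := (BinaryQuadraticForm.classNumber (-(d : ℤ)) : ℝ) with hh
  have hh0 : 0 ≤ h := by rw [hh]; positivity
  have hTnn : 0 ≤ T := by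
    refine Finset.sum_nonneg fun Q hQ => ?_
    have hD0 : (-(d : ℤ)) < 0 := by omega
    obtain ⟨-, ha, -, -⟩ := (mem_reducedForms_iff hD0).1 hQ
    have : (0 : ℝ) < Q.1 := by exact_mod_cast ha
    positivity
  have e1 : (Real.sqrt d * (Real.pi / 6) + 2.6 * c₀) * T =
      Real.sqrt d / c₀ * (c₀ * (Real.pi / 6 + 2.6 * c₀ / Real.sqrt d) * T) := by
    field_simp
  rw [e1]
  have h1 : Real.sqrt d / c₀ * (c₀ * (Real.pi / 6 + 2.6 * c₀ / Real.sqrt d) * T) ≤ Real.sqrt d / c₀ * h :=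
    mul_le_mul_of_nonneg_left hr (by positivity)
  have h2 : Real.sqrt d / c₀ * h ≤ (Real.sqrt d / c₀ + 0.92) * h := by nlinarith
  linarith

/-- **`Re L(σ, χ) > 0` on `[1 − c/√d, 1)` from the ratio condition `c·(π/6 + 2.6c/√d)·Σ_Q 1/a_Q ≤ h(−d)`**
(`0 < c`, `10c ≤ √d`; odd real primitive `χ` mod `d > 4`). [cite: GoldfeldSchinzel1975, Theorem 1 and Corollary (case d < 0)] -/
theorem LFunction_re_pos_of_ratio {d : ℕ} [NeZero d] (hd : 4 < d)
    {χ : DirichletCharacter ℂ d} (hprim : χ.IsPrimitive) (hquad : χ.IsQuadratic) (hodd : χ.Odd)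
    {c₀ : ℝ} (hc0 : 0 < c₀) (h10 : 10 * c₀ ≤ Real.sqrt d)
    (hr : c₀ * (Real.pi / 6 + 2.6 * c₀ / Real.sqrt d) * ∑ Q ∈ reducedForms (-(d : ℤ)), (1 : ℝ) / (Q.1 : ℝ) ≤
      (BinaryQuadraticForm.classNumber (-(d : ℤ)) : ℝ))
    {σ : ℝ} (hσ : 1 - c₀ / Real.sqrt d ≤ σ) (hσ1 : σ < 1) : 0 < (χ.LFunction σ).re :=
  LFunction_re_pos_of_odd_quadratic_summed hd hprim hquad hodd hc0 h10
    (classSum_condition_of_ratio hd hc0 hr) hσ hσ1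

/-- **`1 − β > c/√d` from the ratio condition** (every real zero `β < 1`; odd real primitive `χ` mod `d > 4`).
[cite: GoldfeldSchinzel1975, Theorem 1 and Corollary (case d < 0)] -/
theorem one_sub_realZero_gt_of_ratio {d : ℕ} [NeZero d] (hd : 4 < d)
    {χ : DirichletCharacter ℂ d} (hprim : χ.IsPrimitive) (hquad : χ.IsQuadratic) (hodd : χ.Odd)
    {c₀ : ℝ} (hc0 : 0 < c₀) (h10 : 10 * c₀ ≤ Real.sqrt d)
    (hr : c₀ * (Real.pi / 6 + 2.6 * c₀ / Real.sqrt d) * ∑ Q ∈ reducedForms (-(d : ℤ)), (1 : ℝ) / (Q.1 : ℝ) ≤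
      (BinaryQuadraticForm.classNumber (-(d : ℤ)) : ℝ))
    {β : ℝ} (hβ1 : β < 1) (hz : χ.LFunction β = 0) : c₀ / Real.sqrt d < 1 - β :=
  one_sub_realZero_gt_of_classSum hd hprim hquad hodd hc0 h10 (classSum_condition_of_ratio hd hc0 hr) hβ1 hz

/-! ### Field side: `h(−d) = h_K` -/

variable {K : Type*} [Field K] [NumberField K]

/-- **Field side**: for every imaginary quadratic field `K` with `d_K = −d` (`d > 4`) and the odd real primitive
character `χ` mod `d` (the Kronecker character of `K`): if `0 < c`, `10c ≤ √d` and
`c·(π/6 + 2.6c/√d)·Σ_{Q reduced of disc −d} 1/a_Q ≤ h_K`, then every real zero `β < 1` of `L(s, χ)` has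
`1 − β > c/√d` (`h(−d) = h_K`, tree `Quadratic.card_reducedForms_eq_classNumber`).
[cite: GoldfeldSchinzel1975, Theorem 1 and Corollary (case d < 0)] -/
theorem one_sub_realZero_gt_of_ratio_field (h2 : Module.finrank ℚ K = 2) {d : ℕ} [NeZero d]
    (hdK : NumberField.discr K = -(d : ℤ)) (hd : 4 < d) {χ : DirichletCharacter ℂ d}
    (hprim : χ.IsPrimitive) (hquad : χ.IsQuadratic) (hodd : χ.Odd)
    {c₀ : ℝ} (hc0 : 0 < c₀) (h10 : 10 * c₀ ≤ Real.sqrt d)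
    (hr : c₀ * (Real.pi / 6 + 2.6 * c₀ / Real.sqrt d) * ∑ Q ∈ reducedForms (-(d : ℤ)), (1 : ℝ) / (Q.1 : ℝ) ≤
      (NumberField.classNumber K : ℝ))
    {β : ℝ} (hβ1 : β < 1) (hz : χ.LFunction β = 0) : c₀ / Real.sqrt d < 1 - β := by
  have hdneg : NumberField.discr K < 0 := by rw [hdK]; omega
  have hh := card_reducedForms_eq_classNumber h2 hdneg
  rw [hdK] at hh
  have hr' : c₀ * (Real.pi / 6 + 2.6 * c₀ / Real.sqrt d) * ∑ Q ∈ reducedForms (-(d : ℤ)), (1 : ℝ) / (Q.1 : ℝ) ≤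
      (BinaryQuadraticForm.classNumber (-(d : ℤ)) : ℝ) := by
    rw [hh]; exact hr
  exact one_sub_realZero_gt_of_ratio hd hprim hquad hodd hc0 h10 hr' hβ1 hz

end ClassSumRepulsion

end Literature.NumberTheory.LFunctions
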